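import Summits.HodgeConjecture.HodgeConjecture.Cruxes.BlochSeedDiscOne.RBDoorChainSheafCrux
import Summits.HodgeConjecture.HodgeConjecture.Cruxes.BlochSeedDiscOne.SeedCheckerSplitBlock
import Literature.AlgebraicGeometry.HodgeTheory.ChernCharacterBettiRescale

/-!
# The R-B door chain, second terminus — RESCALE COVARIANCE of the sheaf door's output, and the UP-TO-SCALE stub shape for
# `Cruxes/SheafSeedGaussSq/Lines/sheafdoor.lean` (answer to c5c8-1 g54 HAZARD (f5′); seat `hsemireg-sheaf8-1` g9, 2026-08-31)

Token: `line stmt-HodgeConjecture-18881 Cruxes/BlochSeedDiscOne/Lines/birth.lean 814a6a70c14e831a stub_rung_pad4_seedAt`.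

HONEST FRAMING.  Wiring + linear algebra over the fields of `ChernCharacterBetti`; nothing here says 18881 ∕ 30548 ∕ 19780 ∕ H2 ∕ HC_AV ∕ HC_CM ∕ HC
is proved; R-B ≠ 18881; typed ≠ proved.

THE HAZARD (c5c8-1 g54 memo §3 (f5′), after `ChernCharacterBettiRescale`): the crux `SheafSeedGaussSq` is headed `∀ C : ChernCharacterBetti`, a
`ℚˣ`-rescaling torsor (`C.rescale t : chᵢ ↦ tⁱ·chᵢ` is again an inhabitant); a stub `∀ C, Rung2aSheaf C {4} 14` at FIXED height 14 asserts honest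
letter blocks for every rescaling of the (intended) Chern character — not plausibly true.  The honest stub quantifies the scale:
`∀ C, ∃ t ≠ 0, Rung2aSheaf (C.rescale t ht) {4} 14`.  THIS FILE makes that stub compose BY NAME to the crux, by proving that the sheaf door's
output is COVARIANT under rescaling: `HasHyperbolicBFSheafSeedOn C' N d I → HasHyperbolicBFSheafSeedOn C N d I` whenever `C'.chᵢ = sⁱ·C.chᵢ`
(`s ∈ ℚˣ`; both directions between `C` and `C.rescale t`): rescale the hyperplane datum `a ↦ s⁻¹·a` on the SAME embedding (`h_K ↦ s⁻¹·h_K`,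
hyperbolicity is scale-free: the tree's `isHyperbolicWeilType_smul_iff`), the Weil class `w ↦ s⁻ᴺ·w` (still in the Weil plane, rational,
non-zero) and the free coefficients `c_p ↦ c_p`, `q ↦ q`; the SAME bundle `𝓔` with the SAME semiregularity serves.
RESULT: `sheafSeedGaussSq_of_rung2aSheaf_upToScale : (∀ C, ∃ t (ht : t ≠ 0) I h, Rung2aSheaf (C.rescale t ht) I h) → SheafSeedGaussSq` and the
director's `{4}`∕`14` shape up to scale.  No `sorry`, no def, no instance; axioms standard.  (The twisted-class level
`HasHyperbolicSeedOn (twistedReflexiveClass C AdmTw')` is covariant too — `B₀ ↦ s·B₀` — but is not needed and not typed here.)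

References: [Fulton1998] Ex. 3.2.3 (homogeneity of `chᵢ`); [vanGeemen1994HodgeAV] 5.2–5.4 (hyperbolicity); [BuchweitzFlenner2003] §5.
-/

set_option linter.dupNamespace false
set_option autoImplicit false

noncomputable section

open CategoryTheory AlgebraicGeometry
open Literature.AlgebraicGeometry Literature.AlgebraicGeometry.Motives Literature.AlgebraicGeometry.HodgeTheory
open Literature.AlgebraicTopology.SingularHomology

namespace Summit.HodgeConjecture.HodgeConjecture.Cruxes.BlochSeedDiscOne.RBDoorChainSheafCrux

open Summit.HodgeConjecture.HodgeConjecture.Cruxes.BlochSeedDiscOne.Anchor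
open Summit.HodgeConjecture.HodgeConjecture.Cruxes.BlochSeedDiscOne.SeedChecker
open Summit.HodgeConjecture.HodgeConjecture.Cruxes.BlochSeedDiscOne.SeedChecker.SplitBlock
open Summit.Ventures.HSemireg Summit.Ventures.HSemireg.Pad4Tower

/-- `(c • x)ⁱ = cⁱ • xⁱ` (private copy of the tree's `cupPowTwo_smul`, as in `SeedChecker` ∕ `ChernCharacterBettiRescale`). [cite: HatcherAT2002, §3.2] -/
private theorem cupPowTwo_smul_aux {Y : Type} [TopologicalSpace Y] (c : ℂ) (x : singularCohomology ℂ ℂ Y 2)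
    (i : ℕ) : cupPowTwo (c • x) i = c ^ i • cupPowTwo x i := by
  induction i with
  | zero => rw [cupPowTwo_zero, cupPowTwo_zero, pow_zero, one_smul]
  | succ i ih =>
    rw [cupPowTwo_succ, cupPowTwo_succ, ih]
    simp only [map_smul, LinearMap.smul_apply, smul_smul, pow_succ, mul_comm]

/-! ## §1 Covariance of the one-model sheaf seed under a degree-wise rescaling of `C` -/

section Covariance

variable {C C' : ChernCharacterBetti} {s : ℚ}

/-- **one-model BF sheaf seed, covariant**: if `C'.chᵢ = sⁱ·C.chᵢ` (`s ≠ 0`) then a seed for `(C, h, w)` is a seed for `(C', s·h, sᴺ·w)` — same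
bundle, same window, same semiregularity; `q`, `c_p` unchanged. [cite: Fulton1998, Example 3.2.3] [cite: BuchweitzFlenner2003, §5 (I-semiregular)] -/
theorem hasBFSheafSeedOn_of_ch_eq_pow_smul (hch : ∀ (X : SchemeOver ℂ) (E : X.left.Modules) (i : ℕ), C'.ch X E i = ((s ^ i : ℚ) : ℂ) • C.ch X E i)
    {n : ℕ} {I : Finset ℕ} {P : AbelianVariety ℂ} {h : complexBetti P.X 2} {w : complexBetti P.X (2 * n)}
    (hS : HasBFSheafSeedOn C n I P h w) :
    HasBFSheafSeedOn C' n I P (((s : ℚ) : ℂ) • h) (((s ^ n : ℚ) : ℂ) • w) := by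
  obtain ⟨E₀, hE₀, q, c, hnI, hsr, hchn, hchp⟩ := hS
  refine ⟨E₀, hE₀, q, c, hnI, hsr, ?_, fun p hp hpn => ?_⟩
  · rw [hch, hchn, smul_add, cupPowTwo_smul_aux, smul_smul, smul_smul, Rat.cast_pow, mul_comm ((s : ℂ) ^ n) ((q : ℚ) : ℂ)]
  · rw [hch, hchp p hp hpn, cupPowTwo_smul_aux, smul_smul, smul_smul, Rat.cast_pow, mul_comm ((s : ℂ) ^ p) ((c p : ℚ) : ℂ)]

/-- **hyperbolic one-model BF sheaf seed, covariant**: `C'.chᵢ = sⁱ·C.chᵢ` (`s ≠ 0`) ⟹ `HasHyperbolicBFSheafSeedOn C N d I → HasHyperbolicBFSheafSeedOn C' N d I`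
(hyperplane datum `a ↦ s·a` on the same embedding, `h_K ↦ s·h_K` — hyperbolicity by `isHyperbolicWeilType_smul_iff`; Weil class `w ↦ sᴺ·w`).
[cite: vanGeemen1994HodgeAV, 5.2–5.4] [cite: Fulton1998, Example 3.2.3] -/
theorem hasHyperbolicBFSheafSeedOn_of_ch_eq_pow_smul (hs : s ≠ 0)
    (hch : ∀ (X : SchemeOver ℂ) (E : X.left.Modules) (i : ℕ), C'.ch X E i = ((s ^ i : ℚ) : ℂ) • C.ch X E i)
    {N d : ℕ} {I : Finset ℕ} (hS : HasHyperbolicBFSheafSeedOn C N d I) : HasHyperbolicBFSheafSeedOn C' N d I := by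
  obtain ⟨P, ψ₀, e, a, w, hP, hψ, ha, ha0, hhyp, hwW, hwr, hw0, hseed⟩ := hS
  have hs' : ((s : ℚ) : ℂ) ≠ 0 := by exact_mod_cast hs
  have hsN : ((s ^ N : ℚ) : ℂ) ≠ 0 := by exact_mod_cast pow_ne_zero N hs
  -- the K-symmetrised class is linear in `a`
  have hlin : (d : ℂ) • complexBetti.map e.ι 2 (((s : ℚ) : ℂ) • a) +
      complexBetti.map ψ₀.hom.hom.hom 2 (complexBetti.map e.ι 2 (((s : ℚ) : ℂ) • a)) =
      ((s : ℚ) : ℂ) • ((d : ℂ) • complexBetti.map e.ι 2 a + complexBetti.map ψ₀.hom.hom.hom 2 (complexBetti.map e.ι 2 a)) := by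
    rw [map_smul, map_smul, smul_add, smul_comm]
  refine ⟨P, ψ₀, e, ((s : ℚ) : ℂ) • a, ((s ^ N : ℚ) : ℂ) • w, hP, hψ, ha.smul s, smul_ne_zero hs' ha0, ?_,
    Submodule.smul_mem _ _ hwW, hwr.smul (s ^ N), smul_ne_zero hsN hw0, ?_⟩
  · rw [hlin]
    exact (isHyperbolicWeilType_smul_iff hs').2 hhyp
  · rw [hlin]
    exact hasBFSheafSeedOn_of_ch_eq_pow_smul hch hseed

/-- `C ↦ C.rescale t`: a hyperbolic sheaf seed for `C` is one for every rescaling of `C`. [cite: Fulton1998, Example 3.2.3] -/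
theorem hasHyperbolicBFSheafSeedOn_rescale {t : ℚ} (ht : t ≠ 0) {N d : ℕ} {I : Finset ℕ} (hS : HasHyperbolicBFSheafSeedOn C N d I) :
    HasHyperbolicBFSheafSeedOn (C.rescale t ht) N d I :=
  hasHyperbolicBFSheafSeedOn_of_ch_eq_pow_smul ht (fun X E i => ChernCharacterBetti.rescale_ch C t ht X E i) hS

/-- `C.rescale t ↦ C`: a hyperbolic sheaf seed for SOME rescaling of `C` is one for `C` (`C.chᵢ = t⁻ⁱ·(C.rescale t).chᵢ`). [cite: Fulton1998, Example 3.2.3] -/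
theorem hasHyperbolicBFSheafSeedOn_of_rescale {t : ℚ} (ht : t ≠ 0) {N d : ℕ} {I : Finset ℕ}
    (hS : HasHyperbolicBFSheafSeedOn (C.rescale t ht) N d I) : HasHyperbolicBFSheafSeedOn C N d I := by
  refine hasHyperbolicBFSheafSeedOn_of_ch_eq_pow_smul (inv_ne_zero ht) (fun X E i => ?_) hS
  rw [ChernCharacterBetti.rescale_ch, smul_smul, ← Rat.cast_mul, inv_pow, inv_mul_cancel₀ (pow_ne_zero i ht), Rat.cast_one, one_smul]

/-- so the sheaf door's output is INVARIANT under rescaling. [cite: Fulton1998, Example 3.2.3] -/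
theorem hasHyperbolicBFSheafSeedOn_rescale_iff {t : ℚ} (ht : t ≠ 0) {N d : ℕ} {I : Finset ℕ} :
    HasHyperbolicBFSheafSeedOn (C.rescale t ht) N d I ↔ HasHyperbolicBFSheafSeedOn C N d I :=
  ⟨hasHyperbolicBFSheafSeedOn_of_rescale ht, hasHyperbolicBFSheafSeedOn_rescale ht⟩

end Covariance

/-! ## §2 The UP-TO-SCALE stub shapes compose BY NAME to `SheafSeedGaussSq` -/

section UpToScale

/-- **hyperbolic BF sheaf seeds for SOME rescaling of every `C`, on shifted-initial windows ⟹ `SheafSeedGaussSq`.**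
[cite: BuchweitzFlenner2003, §5 (I-semiregular)] [cite: Fulton1998, Example 3.2.3] -/
theorem sheafSeedGaussSq_of_hyperbolicBFSheafSeedsOn_upToScale
    (h : ∀ C : ChernCharacterBetti, ∃ (t : ℚ) (ht : t ≠ 0) (I : Finset ℕ),
      I.IsShiftedInitialSegment ∧ HasHyperbolicBFSheafSeedOn (C.rescale t ht) 4 1 I) :
    Summit.HodgeConjecture.HodgeConjecture.Theses.EightfoldTwistedSheafSeeds.SheafSeedGaussSq :=
  sheafSeedGaussSq_of_hyperbolicBFSheafSeedsOn fun C => by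
    obtain ⟨t, ht, I, hI, hS⟩ := h C
    exact ⟨I, hI, hasHyperbolicBFSheafSeedOn_of_rescale ht hS⟩

variable {C : ChernCharacterBetti}

/-- v41's sheaf-door rung at ANY window, re-windowed to `{1..8}` (restated here so that this leaf does not wait on the hub build of
`RBDoorChainSheafCruxSplitBlock`). [cite: BuchweitzFlenner2003, §5 (I-semiregular)] -/
theorem hasHyperbolicBFSheafSeedOn_icc_of_rung2aSheaf {I : Finset ℕ} {h : ℤ} (h2a : Rung2aSheaf C I h) :
    HasHyperbolicBFSheafSeedOn C 4 1 (Finset.Icc 1 8) := by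
  obtain ⟨E₀, ψ₀, hE, hψ, δ, hδ, _⟩ := h2a
  exact hasHyperbolicBFSheafSeedOn_of_sheafSeedCheckRankFree hE hψ (sheafSeedCheckRankFree_rewindow hδ)

/-- **THE UP-TO-SCALE SHEAF-DOOR RUNG FOR EVERY `C` ⟹ `SheafSeedGaussSq` BY NAME** (any window, any height, some rescaling per `C`).
[cite: BuchweitzFlenner2003, §5 (I-semiregular)] [cite: Fulton1998, Example 3.2.3] -/
theorem sheafSeedGaussSq_of_rung2aSheaf_upToScale
    (h2a : ∀ C : ChernCharacterBetti, ∃ (t : ℚ) (ht : t ≠ 0) (I : Finset ℕ) (h : ℤ), Rung2aSheaf (C.rescale t ht) I h) :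
    Summit.HodgeConjecture.HodgeConjecture.Theses.EightfoldTwistedSheafSeeds.SheafSeedGaussSq :=
  sheafSeedGaussSq_of_hyperbolicBFSheafSeedsOn_upToScale fun C => by
    obtain ⟨t, ht, I, h, h2⟩ := h2a C
    exact ⟨t, ht, Finset.Icc 1 8, Finset.isShiftedInitialSegment_Icc le_rfl 8, hasHyperbolicBFSheafSeedOn_icc_of_rung2aSheaf h2⟩

/-- **THE HONEST FORM OF R19.850 (1)'S STUB (c5c8 g54 (f5′)): `(∀ C, ∃ t ≠ 0, Rung2aSheaf (C.rescale t _) {4} 14) → SheafSeedGaussSq`** — σ₃ alone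
certified at height 14 for SOME rescaling of each `C`; the `_of` of `Lines/sheafdoor.lean` is again ONE line.
[cite: BuchweitzFlenner2003, §5 (I-semiregular)] [cite: Fulton1998, Example 3.2.3] -/
theorem sheafSeedGaussSq_of_rung2aSheaf_four_upToScale
    (h2a : ∀ C : ChernCharacterBetti, ∃ (t : ℚ) (ht : t ≠ 0), Rung2aSheaf (C.rescale t ht) {4} 14) :
    Summit.HodgeConjecture.HodgeConjecture.Theses.EightfoldTwistedSheafSeeds.SheafSeedGaussSq :=
  sheafSeedGaussSq_of_rung2aSheaf_upToScale fun C => by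
    obtain ⟨t, ht, h2⟩ := h2a C
    exact ⟨t, ht, {4}, 14, h2⟩

/-- and from the rank-free checker up to scale (anchor, design, kit, sheaf, window, scale may depend on `C`).
[cite: BuchweitzFlenner2003, §5 (I-semiregular)] [cite: Fulton1998, Example 3.2.3] -/
theorem sheafSeedGaussSq_of_sheafSeedCheckRankFree_upToScale
    (h : ∀ C : ChernCharacterBetti, ∃ (t : ℚ) (ht : t ≠ 0) (E₀ : AbelianVariety ℂ) (ψ₀ : E₀ ⟶ E₀) (_ : E₀.dim = 1)
      (_ : ψ₀ ≫ ψ₀ = -(1 • 𝟙 E₀)) (D : Design) (I : Finset ℕ) (K : AnchorKit E₀ ψ₀) (𝓔 : (pad4Anchor E₀).X.left.Modules),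
      D.SheafSeedCheckRankFree (C.rescale t ht) I K 𝓔) :
    Summit.HodgeConjecture.HodgeConjecture.Theses.EightfoldTwistedSheafSeeds.SheafSeedGaussSq :=
  sheafSeedGaussSq_of_hyperbolicBFSheafSeedsOn_upToScale fun C => by
    obtain ⟨t, ht, E₀, ψ₀, hE, hψ, D, I, K, 𝓔, hc⟩ := h C
    exact ⟨t, ht, Finset.Icc 1 8, Finset.isShiftedInitialSegment_Icc le_rfl 8,
      hasHyperbolicBFSheafSeedOn_of_sheafSeedCheckRankFree hE hψ (sheafSeedCheckRankFree_rewindow hc)⟩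

end UpToScale

/-- AUDIT: wiring + linear algebra; nothing decided about any crux. -/
theorem audit_nothing_decided_rescale : True := trivial

end Summit.HodgeConjecture.HodgeConjecture.Cruxes.BlochSeedDiscOne.RBDoorChainSheafCrux

end
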